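import Summits.ValiantsHypothesis.ValiantsHypothesis.Theorems.LacunarySymmetroidMatrixDescartesCensusFullAlternation
import Summits.ValiantsHypothesis.ValiantsHypothesis.Theorems.LacunarySymmetroidMatrixDescartesCensusChamberNewton
import Summits.ValiantsHypothesis.ValiantsHypothesis.Theorems.LacunarySymmetroidMatrixDescartesDoorA26WallBubblingConeTransfer
import Summits.ValiantsHypothesis.ValiantsHypothesis.Theorems.LacunarySymmetroidMatrixDescartesDoorA26WallBubblingSecondOrderClusters

/-!
# `DoorA26` line `wall_bubbling` — SIGNED CLUSTER DATA: the chamber's alternation signs survive into every stage of the bubbling chain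

HONEST FRAMING.  Object-search cell `pub-symmetroid`; crux `Theses.LacunarySymmetroid.DoorA26` (stmt-ValiantsHypothesis-19979; OPEN,
typed, never asserted).  Line `Cruxes/DoorA26/Lines/wall_bubbling.lean` (val-idea-15), obligation (M) `Stmt.stub_mixedWalls` (slot W1).
W1's KILL(j) (`…WallBubblingMixedParity.mixedWall_parity_kill`) consumes, at every stage `ν` of an accumulation of twenties, (a) the
mixed-wall block anatomy `hblock` (W3, `…SecondOrderMixedWall.mixedWall_hblock`), and (b) OPPOSITE SIGNS `G^ν_jj · G^ν_ii < 0`,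
`G^ν_jk · G^ν_jl ≤ 0` of Gram entries — the chamber's Descartes alternation signs.  The chain's `Bubbling.ClusterLimit` keeps moduli,
limits and (W3's re-run) realisability of the stage vectors but FORGETS their signs.  This file supplies the signs (def-free):

* `twenty_sign_law` — **SIGN LAW FOR A REAL TWENTY IN A CONE**: if `σ : Fin 21 → Fin 6 × Fin 6` lists every pair up to swap, the REAL
  exponent vector `δ` lies in the open cone of `σ` (`StrictMono (pairSum δ ∘ σ)`) and symmetric letters `S` give `≥ 20` positive
  det-zeros, then ALL 21 polar Gram entries are non-zero and ALTERNATE along `σ` up to one global sign: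
  `0 < (−1)^(t+t') · polar (S (σ t)) · polar (S (σ t'))`.  Proof = the cone-transfer route of `…WallBubblingConeTransfer` run for signs:
  persistent brackets (`Census.RealExp.exists_persistent_brackets`) → a rational point of the cone in the bracket ball → the explicit
  integer support (`nat_support_explicit`) with the SAME letters and `≥ 20` distinct positive roots → full alternation of a Descartes-sharp
  polynomial (`Census.pow_rank_mul_coeff_mul_coeff_pos_of_sharp`, `Census.support_det_of_chamber_sharp`) → the coefficient dictionary
  (`Census.coeff_det_diag_of_chamber` = `det Sᵢ`, `Census.coeff_det_pair_of_chamber` = `2·polar`).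
* `zeros_of_twenty` — the chain's S3a (`zeros_of_mem_twentyLocus`) for GIVEN letters, so that the sign law attaches to the SAME letters.
* `closure_twentyLocus_facet_split` / `mem_closure_inter_cone_of_row` — ONE-SIDEDNESS at a generic facet point of `σ` (equality at
  position `t`, strict elsewhere; `facet_nhds`): an accumulation of twenties at `δ₀` comes from cone `σ` or from the swapped cone
  `σ ∘ swap(t, t+1)`, and if the integer door-A row holds on one of them (`realCone_row_of_natRow`) then from the other.

NOT here: the signed re-run of the chain's cluster construction (part 2, `…WallBubblingSignedClusterData`), the KILL itself
(`…WallBubblingKillSide`), the collapse regime, anything facet-uniform.  Nothing in this file bears on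
(M)/(W)/(R) themselves, on `DoorA26`, on `MatrixDescartes` (18050) or on `VP ≠ VNP`; registers unchanged.

Cell `pub-symmetroid`, seat val-sym-door-p2 g12 (W1 #10a, part 1, of R2694 (B)), `--supports stmt-ValiantsHypothesis-19979 --as helper`.
[folklore] Descartes' rule of signs + rational approximation; Bolzano–Weierstrass bookkeeping (the chain's, val-idea-15 g1 / val-port-4 g1 /
W3 val-sym-door-p4 g10, re-run with one extra field). [this work] the packaging.
-/

-- `Summit.ValiantsHypothesis.ValiantsHypothesis.…` repeats a component by the D-0017 layout
-- (single-conjunct summit), which the `dupNamespace` linter flags; the name is mandated.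
set_option linter.dupNamespace false

namespace Summit.ValiantsHypothesis.ValiantsHypothesis.Theorems.LacunarySymmetroidMatrixDescartes.WallBubbling.SecondOrder

open Finset Filter Topology Polynomial
open scoped BigOperators
open Summit.ValiantsHypothesis.ValiantsHypothesis.Theorems.LacunarySymmetroidMatrixDescartes.WallBubbling.Bubbling
open Summit.ValiantsHypothesis.ValiantsHypothesis.Theorems.LacunarySymmetroidMatrixDescartes.Census.RealExp
  (exists_persistent_brackets continuous_det_expPencil card_monotone_two_six exists_zero_of_mul_neg)

/-! ## §1 The sign law for a real twenty in a cone -/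

/-- **SIGN LAW FOR A REAL TWENTY IN A CONE.**  Let `σ : Fin 21 → Fin 6 × Fin 6` list every pair up to swap, let the REAL exponent
vector `δ` lie in the open cone of `σ` (its pair sums increase strictly along `σ`), and let symmetric `2 × 2` letters `S` give at least
`20` positive det-zeros of the real-power pencil `∑ x^{δₗ} Sₗ` (a twenty).  Then the 21 polar Gram entries listed by `σ` are all non-zero
and alternate in sign along `σ`, up to one global sign: `0 < (−1)^(t+t') · polar (S (σ t)) · polar (S (σ t'))` for all positions `t, t'`.
(Descartes' rule at the sharp count, transported from an integer support with the same letters.) [folklore] -/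
theorem twenty_sign_law (σ : Fin 21 → Fin 6 × Fin 6)
    (hcov : ∀ p : Fin 6 × Fin 6, ∃ t : Fin 21, σ t = p ∨ σ t = p.swap)
    (δ : Fin 6 → ℝ) (hδ : StrictMono ((fun p : Fin 6 × Fin 6 => δ p.1 + δ p.2) ∘ σ))
    (S : Fin 6 → Matrix (Fin 2) (Fin 2) ℝ) (hS : ∀ l, (S l).IsSymm)
    (h20 : 20 ≤ {x : ℝ | 0 < x ∧ (∑ l, (x ^ (δ l)) • S l).det = 0}.ncard) (t t' : Fin 21) :
    0 < (-1 : ℝ) ^ ((t : ℕ) + t') * (polar (S (σ t).1) (S (σ t).2) * polar (S (σ t').1) (S (σ t').2)) := by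
  classical
  rw [Census.RealExp.ncard_rpow_eq_ncard_exp δ S] at h20
  obtain ⟨n, hnB, a, b, hab, hdisj, r, hr, hball⟩ :=
    exists_persistent_brackets (m := 2) (K := 6) (B := 19) (by rw [card_monotone_two_six]) δ S (by omega)
  -- the open cone gives a second radius
  obtain ⟨r', hr', hball'⟩ := Metric.isOpen_iff.mp (isOpen_realCone σ) δ hδ
  -- a point of `(1/D) ℤ⁶` within `min r r'`
  set ρ : ℝ := min r r' with hρ
  have hρpos : 0 < ρ := lt_min hr hr'
  set D : ℕ := ⌈1 / ρ⌉₊ + 1 with hD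
  have hD0 : 0 < D := Nat.succ_pos _
  have hDpos : (0 : ℝ) < D := by exact_mod_cast hD0
  have hDρ : 1 / (D : ℝ) < ρ := by
    have h1 : 1 / ρ < (D : ℝ) := by
      rw [hD]; push_cast
      exact (Nat.le_ceil (1 / ρ)).trans_lt (lt_add_one _)
    exact (one_div_lt hDpos hρpos).mpr h1
  set z : Fin 6 → ℤ := fun l => ⌊δ l * D⌋ with hz
  set δ' : Fin 6 → ℝ := fun l => (z l : ℝ) / D with hδ'
  have hdist : dist δ' δ < ρ := by
    rw [dist_pi_lt_iff hρpos]
    intro l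
    rw [Real.dist_eq]
    have h1 : (z l : ℝ) ≤ δ l * D := Int.floor_le _
    have h2 : δ l * D < (z l : ℝ) + 1 := Int.lt_floor_add_one _
    have heq : (z l : ℝ) / D - δ l = ((z l : ℝ) - δ l * D) / D := by field_simp
    have h3 : |(z l : ℝ) / D - δ l| ≤ 1 / D := by
      rw [heq, abs_le]
      constructor
      · rw [le_div_iff₀ hDpos]
        have : -(1 / (D : ℝ)) * D = -1 := by field_simp
        rw [this]; linarith
      · exact div_le_div_of_nonneg_right (by linarith) hDpos.le
    exact h3.trans_lt hDρ
  have hsign := hball δ' (lt_of_lt_of_le hdist (min_le_left _ _))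
  have hcone' : StrictMono ((fun p : Fin 6 × Fin 6 => δ' p.1 + δ' p.2) ∘ σ) :=
    hball' (Metric.mem_ball.mpr (lt_of_lt_of_le hdist (min_le_right _ _)))
  -- zeros of the perturbed pencil inside the brackets
  have hzeros : ∀ i, ∃ w ∈ Set.Ioo (a i) (b i),
      (∑ l, Real.exp (((z l : ℝ) / D) * w) • S l).det = 0 :=
    fun i => exists_zero_of_mul_neg (hab i)
      (continuous_det_expPencil (fun l => (z l : ℝ) / D) S).continuousOn (hsign i)
  choose w hwmem hw0 using hzeros
  have hwmono : StrictMono w := by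
    intro i j hij
    have h1 := (hwmem i).2
    have h2 := (hwmem j).1
    have h3 := hdisj i j hij
    linarith
  -- the integer support, in the same cone
  obtain ⟨e, hecast, he⟩ := nat_support_explicit z hD0 S
  have hecone : StrictMono ((fun p : Fin 6 × Fin 6 => e p.1 + e p.2) ∘ σ) := by
    rw [Fin.strictMono_iff_lt_succ]
    intro i
    have h := (Fin.strictMono_iff_lt_succ.mp hcone') i
    simp only [Function.comp_apply, hδ'] at h ⊢
    have h' : ((z (σ i.castSucc).1 : ℝ) + z (σ i.castSucc).2) < (z (σ i.succ).1 : ℝ) + z (σ i.succ).2 := by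
      have := mul_lt_mul_of_pos_right h hDpos
      field_simp at this
      linarith
    have h'' : ((e (σ i.castSucc).1 : ℝ) + e (σ i.castSucc).2) < (e (σ i.succ).1 : ℝ) + e (σ i.succ).2 := by
      rw [hecast, hecast, hecast, hecast]; linarith
    exact_mod_cast h''
  set P : ℝ[X] := (∑ l, (X : ℝ[X]) ^ e l • (S l).map C).det with hP
  have hProot : ∀ i, P.eval (Real.exp (w i / D)) = 0 := fun i => by rw [hP, he]; exact hw0 i
  have hn0 : 0 < n := by omega
  have hPne : P ≠ 0 := by
    intro h0
    have h1 : P.eval (Real.exp (a ⟨0, hn0⟩ / D)) = 0 := by rw [h0, eval_zero]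
    rw [hP, he] at h1
    have h2 := hsign ⟨0, hn0⟩
    rw [h1, zero_mul] at h2
    exact lt_irrefl 0 h2
  set xs : Fin n → ℝ := fun i => Real.exp (w i / D) with hxs
  have hxsinj : Function.Injective xs := by
    intro i j hij
    have h1 := Real.exp_injective hij
    have h2 : w i = w j := by
      have h3 : w i / D * D = w j / D * D := by rw [h1]
      rwa [div_mul_cancel₀ _ hDpos.ne', div_mul_cancel₀ _ hDpos.ne'] at h3
    exact hwmono.injective h2
  have hsub : univ.image xs ⊆ P.roots.toFinset.filter (fun x => 0 < x) := by
    intro x hx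
    rw [Finset.mem_image] at hx
    obtain ⟨i, -, rfl⟩ := hx
    rw [Finset.mem_filter, Multiset.mem_toFinset, mem_roots hPne, IsRoot.def]
    exact ⟨hProot i, Real.exp_pos _⟩
  have hcard := Finset.card_le_card hsub
  rw [Finset.card_image_of_injective _ hxsinj, Finset.card_univ, Fintype.card_fin] at hcard
  -- Descartes-sharp polynomial on a chamber support: full alternation along `σ`
  have hZ20 : 20 ≤ (P.roots.toFinset.filter (fun x => 0 < x)).card := by omega
  have hsupp : P.support = (univ : Finset (Fin 21)).image (fun u => e (σ u).1 + e (σ u).2) := by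
    rw [hP]; exact Census.support_det_of_chamber_sharp σ hcov e hecone S hZ20
  have hEinj : Function.Injective (fun u : Fin 21 => e (σ u).1 + e (σ u).2) := hecone.injective
  have hsuppcard : P.support.card = 21 := by
    rw [hsupp, Finset.card_image_of_injective _ hEinj, Finset.card_univ, Fintype.card_fin]
  have hsharp : P.support.card ≤ (P.roots.toFinset.filter (fun x => 0 < x)).card + 1 := by omega
  have hmem : ∀ u : Fin 21, e (σ u).1 + e (σ u).2 ∈ P.support := fun u => by
    rw [hsupp]; exact Finset.mem_image.mpr ⟨u, Finset.mem_univ _, rfl⟩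
  have hrank : ∀ u : Fin 21, (P.support.filter (fun c => c < e (σ u).1 + e (σ u).2)).card = u := by
    intro u
    rw [hsupp, ← Census.image_pairSum_eq_of_chamber σ hcov e]
    exact Census.card_filter_lt_of_chamber σ hcov e hecone u
  have key := Census.pow_rank_mul_coeff_mul_coeff_pos_of_sharp P hsharp (hmem t) (hmem t')
  rw [hrank t, hrank t'] at key
  -- the coefficient dictionary: `coeff = det Sᵢ` on a diagonal pair, `= 2 · polar` on a mixed pair
  have hsym10 : ∀ l, S l 1 0 = S l 0 1 := fun l => by
    have h := congrFun (congrFun (hS l) 1) 0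
    simp only [Matrix.transpose_apply] at h
    exact h.symm
  have hcoeff : ∀ u : Fin 21, ∃ c : ℝ, 0 < c ∧
      P.coeff (e (σ u).1 + e (σ u).2) = c * polar (S (σ u).1) (S (σ u).2) := by
    intro u
    by_cases hdiag : (σ u).1 = (σ u).2
    · refine ⟨1, one_pos, ?_⟩
      have hu : σ u = ((σ u).1, (σ u).1) := Prod.ext rfl hdiag.symm
      rw [← hdiag, hP, Census.coeff_det_diag_of_chamber σ hcov e hecone S hS hu, one_mul, polar_apply, hsym10]
      ring
    · refine ⟨2, two_pos, ?_⟩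
      have hu : σ u = ((σ u).1, (σ u).2) := rfl
      rw [hP, Census.coeff_det_pair_of_chamber σ hcov e hecone S hS hu hdiag, polar_apply, hsym10, hsym10]
      ring
  obtain ⟨c, hc, hct⟩ := hcoeff t
  obtain ⟨c', hc', hct'⟩ := hcoeff t'
  rw [hct, hct'] at key
  have hrw : (-1 : ℝ) ^ ((t : ℕ) + t') * (c * polar (S (σ t).1) (S (σ t).2) * (c' * polar (S (σ t').1) (S (σ t').2)))
      = (c * c') * ((-1 : ℝ) ^ ((t : ℕ) + t') * (polar (S (σ t).1) (S (σ t).2) * polar (S (σ t').1) (S (σ t').2))) := by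
    ring
  rw [hrw] at key
  exact pos_of_mul_pos_right key (mul_pos hc hc').le


/-! ## §2 Twenties with given letters: the Gram vector and twenty sorted zeros -/

/-- **S3a for GIVEN letters.**  If the symmetric letters `S` give `≥ 20` positive det-zeros of `∑ x^{δₗ} Sₗ`, then their polar Gram vector
is non-zero and the associated `expSum` has `20` strictly increasing real zeros (the chain's `zeros_of_mem_twentyLocus`, with the letters
exposed so that the sign law can be attached to the SAME letters). [folklore] -/
theorem zeros_of_twenty (δ : Fin 6 → ℝ) (S : Fin 6 → Matrix (Fin 2) (Fin 2) ℝ)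
    (h20 : 20 ≤ {x : ℝ | 0 < x ∧ (∑ l, (x ^ (δ l)) • S l).det = 0}.ncard) :
    (fun p : Pair => polar (S p.1) (S p.2)) ≠ 0 ∧
      ∃ z : Fin 20 → ℝ, StrictMono z ∧ ∀ j, expSum (fun p : Pair => polar (S p.1) (S p.2)) (pairExp δ) (z j) = 0 := by
  classical
  set Zpos : Set ℝ := {x : ℝ | 0 < x ∧ (∑ l, (x ^ (δ l)) • S l).det = 0} with hZpos
  refine ⟨?_, ?_⟩
  · -- nonzero Gram vector: otherwise the determinant vanishes on `(0, ∞)` and `ncard = 0`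
    intro hG
    have hall : ∀ x : ℝ, 0 < x → (∑ l, (x ^ (δ l)) • S l).det = 0 := by
      intro x hx
      rw [det_rpow_pencil δ S hx]
      refine Finset.sum_eq_zero fun k _ => Finset.sum_eq_zero fun l _ => ?_
      have := congrFun hG (k, l)
      simp only [Pi.zero_apply] at this
      rw [this, zero_mul]
    have hIoi : Zpos = Set.Ioi 0 := by
      ext x
      simp only [hZpos, Set.mem_setOf_eq, Set.mem_Ioi]
      exact ⟨fun h => h.1, fun h => ⟨h, hall x h⟩⟩
    have : Zpos.ncard = 0 := by rw [hIoi]; exact (Set.Ioi_infinite 0).ncard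
    rw [this] at h20
    omega
  · -- twenty sorted positive zeros, then logarithms
    obtain ⟨T, hTsub, hTcard⟩ := Set.exists_subset_card_eq h20
    have hTfin : T.Finite := Set.finite_of_ncard_pos (by omega)
    set TF : Finset ℝ := hTfin.toFinset with hTF
    have hTFcard : TF.card = 20 := by
      rw [hTF, ← Set.ncard_eq_toFinset_card T hTfin]; exact hTcard
    let e : Fin 20 ↪o ℝ := TF.orderEmbOfFin hTFcard
    have heT : ∀ j, e j ∈ T := fun j => by
      have h2 : e j ∈ hTfin.toFinset := Finset.orderEmbOfFin_mem TF hTFcard j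
      exact hTfin.mem_toFinset.mp h2
    have hepos : ∀ j, 0 < e j := fun j => (hTsub (heT j)).1
    refine ⟨fun j => Real.log (e j), ?_, ?_⟩
    · intro i j hij
      exact Real.log_lt_log (hepos i) (e.strictMono hij)
    · intro j
      have hz := (hTsub (heT j)).2
      rw [← det_pencil_exp, Real.exp_log (hepos j)]
      exact hz

/-! ## §3 One-sidedness at a generic facet point -/

/-- Closure of `T` at a point with a neighbourhood `U`: the point is in the closure of `T ∩ U`. [folklore] -/
theorem mem_closure_inter_of_mem_nhds {X : Type*} [TopologicalSpace X] {T U : Set X} {x : X}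
    (hx : x ∈ closure T) (hU : U ∈ 𝓝 x) : x ∈ closure (T ∩ U) := by
  rw [mem_closure_iff_nhds] at hx ⊢
  intro V hV
  obtain ⟨y, hyV, hyT⟩ := hx (V ∩ U) (Filter.inter_mem hV hU)
  exact ⟨y, hyV.1, hyT, hyV.2⟩

/-- **ONE-SIDEDNESS AT A GENERIC FACET POINT.**  Let `σ` be a pair order with canonical pairs (`fst ≤ snd`), `t` a position with
`σ t ≠ σ (t+1)`, and `δ₀` a GENERIC point of the facet at `t` (equality of the `t`-th adjacent pair sums, all other adjacent comparisons
strict).  If twenties accumulate at `δ₀`, they accumulate from the open cone of `σ` or from the open cone of the swapped order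
`σ ∘ swap(t, t+1)`.  The wall itself carries no twenty by the real-exponent Descartes bound of the tree,
`Census.RealExp.realRow_two_six_of_pairSum_eq` (…CensusRealExponentsLocus: a repeated pair sum between two distinct canonical pairs leaves
`≤ 20` exponent classes, hence `≤ 19` zeros on `(0,∞)`). [this work] -/
theorem closure_twentyLocus_facet_split (σ : Fin 21 → Fin 6 × Fin 6) (t : Fin 20)
    (hcan : ∀ i, (σ i).1 ≤ (σ i).2) (hne : σ t.castSucc ≠ σ t.succ) (δ₀ : Fin 6 → ℝ)
    (h_eq : δ₀ (σ t.castSucc).1 + δ₀ (σ t.castSucc).2 = δ₀ (σ t.succ).1 + δ₀ (σ t.succ).2)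
    (h_strict : ∀ i : Fin 20, i ≠ t → δ₀ (σ i.castSucc).1 + δ₀ (σ i.castSucc).2 < δ₀ (σ i.succ).1 + δ₀ (σ i.succ).2)
    (hclos : δ₀ ∈ closure TwentyLocus) :
    δ₀ ∈ closure (TwentyLocus ∩ {δ : Fin 6 → ℝ | StrictMono ((fun p : Fin 6 × Fin 6 => δ p.1 + δ p.2) ∘ σ)}) ∨
    δ₀ ∈ closure (TwentyLocus ∩
      {δ : Fin 6 → ℝ | StrictMono ((fun p : Fin 6 × Fin 6 => δ p.1 + δ p.2) ∘ σ ∘ Equiv.swap t.castSucc t.succ)}) := by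
  obtain ⟨U, hU, hcov⟩ := facet_nhds σ t δ₀ h_eq h_strict
  have hTU := mem_closure_inter_of_mem_nhds hclos hU
  -- `T ∩ U` lies in the union of the two cone parts
  have hsub : TwentyLocus ∩ U ⊆
      (TwentyLocus ∩ {δ : Fin 6 → ℝ | StrictMono ((fun p : Fin 6 × Fin 6 => δ p.1 + δ p.2) ∘ σ)}) ∪
      (TwentyLocus ∩
        {δ : Fin 6 → ℝ | StrictMono ((fun p : Fin 6 × Fin 6 => δ p.1 + δ p.2) ∘ σ ∘ Equiv.swap t.castSucc t.succ)}) := by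
    rintro δ ⟨hδT, hδU⟩
    rcases hcov δ hδU with h | h | h
    · -- on the wall: no twenty
      exfalso
      obtain ⟨S, -, h20⟩ := hδT
      have h19 := Census.RealExp.realRow_two_six_of_pairSum_eq δ (hcan _) (hcan _)
        (fun hp => hne (Prod.ext (Prod.mk.inj hp).1 (Prod.mk.inj hp).2)) h S
      omega
    · exact Or.inl ⟨hδT, h⟩
    · exact Or.inr ⟨hδT, h⟩
  have := closure_mono hsub hTU
  rw [closure_union] at this
  exact this

/-- The swapped order lists the same pairs. [folklore] -/
theorem cover_swap (σ : Fin 21 → Fin 6 × Fin 6) (hcov : ∀ p : Fin 6 × Fin 6, ∃ u : Fin 21, σ u = p ∨ σ u = p.swap)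
    (e : Equiv.Perm (Fin 21)) : ∀ p : Fin 6 × Fin 6, ∃ u : Fin 21, (σ ∘ e) u = p ∨ (σ ∘ e) u = p.swap := by
  intro p
  obtain ⟨u, hu⟩ := hcov p
  exact ⟨e.symm u, by simpa using hu⟩

/-- **ACCUMULATION FROM THE UNCERTIFIED SIDE ONLY.**  At a generic facet point of `σ` at position `t`, if the integer door-A row holds on
the cone of `σ` (a landed chamber: `realCone_row_of_natRow` empties its real cone of twenties), then every accumulation of twenties at
`δ₀` comes from the cone of the swapped order `σ ∘ swap(t, t+1)`. [this work] -/
theorem mem_closure_inter_cone_of_row (σ : Fin 21 → Fin 6 × Fin 6) (t : Fin 20)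
    (hcan : ∀ i, (σ i).1 ≤ (σ i).2) (hne : σ t.castSucc ≠ σ t.succ)
    (hrow : ∀ d : Fin 6 → ℕ, StrictMono ((fun p : Fin 6 × Fin 6 => d p.1 + d p.2) ∘ σ) → PosRootLawOn 2 6 19 d)
    (δ₀ : Fin 6 → ℝ)
    (h_eq : δ₀ (σ t.castSucc).1 + δ₀ (σ t.castSucc).2 = δ₀ (σ t.succ).1 + δ₀ (σ t.succ).2)
    (h_strict : ∀ i : Fin 20, i ≠ t → δ₀ (σ i.castSucc).1 + δ₀ (σ i.castSucc).2 < δ₀ (σ i.succ).1 + δ₀ (σ i.succ).2)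
    (hclos : δ₀ ∈ closure TwentyLocus) :
    δ₀ ∈ closure (TwentyLocus ∩
      {δ : Fin 6 → ℝ | StrictMono ((fun p : Fin 6 × Fin 6 => δ p.1 + δ p.2) ∘ σ ∘ Equiv.swap t.castSucc t.succ)}) := by
  rcases closure_twentyLocus_facet_split σ t hcan hne δ₀ h_eq h_strict hclos with h | h
  · -- the cone of `σ` carries no twenty
    have hempty : TwentyLocus ∩ {δ : Fin 6 → ℝ | StrictMono ((fun p : Fin 6 × Fin 6 => δ p.1 + δ p.2) ∘ σ)} = ∅ := by
      ext δ
      simp only [Set.mem_inter_iff, Set.mem_setOf_eq, Set.mem_empty_iff_false, iff_false, not_and]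
      rintro ⟨S, hS, h20⟩ hcone
      have := realCone_row_of_natRow σ hrow δ hcone S hS
      omega
    rw [hempty, closure_empty] at h
    exact absurd h (Set.notMem_empty _)
  · exact h

end Summit.ValiantsHypothesis.ValiantsHypothesis.Theorems.LacunarySymmetroidMatrixDescartes.WallBubbling.SecondOrder
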